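import Summits.BirchSwinnertonDyer.BirchSwinnertonDyer.Theorems.AlignedTransportAtTwoMainConjectureOfRankZeroBSDAtTwoCubicRelationDoor
import Literature.NumberTheory.IwasawaTheory.ClassicalMuVanishesLayerTwoRelationCertificateTwoSplit
import HarnessLib

/-!
# Route `AlignedTransportAtTwo`, crux C2 `MainConjectureOfRankZeroBSDAtTwo` (stmt-BirchSwinnertonDyer-22298):
# THE LAYER-TWO RELATION DOOR IN COORDINATES ON THE SPLIT STRATUM `Δ_min ≡ 1 (mod 8)` — `μ₂ = 0`, `λ₂ ≤ 2`, `rank₂ Cl(K_m) ≤ 2 ∀ m` for the cubic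
# `2`-torsion field `ℚ(β)` (three primes above `2`, `h(ℚ(β))` odd, ONE unit `≡ ±3 (mod 𝔭'³)`), from ONE relation row `c·(σc)²·σ²c = 1` at layer
# `K_2 = ℚ(β)·ℚ(ζ₁₆)⁺` (degree `12`) written in `𝓞_{ℚ(β)}`

HONEST FRAMING (cell `bsd-f1-sign2`, WIDTH-5 attached prover seat `bsd-line-att-p4` gen 46 on line `birth` of the lead `bsd-line-att-p2`;
`--supports` stmt-BirchSwinnertonDyer-22298, closes nothing; BSD is NOT proved by any of this; the crux C2, its verdict «blocked-on
`Rank1Residual.GreenbergMuConjectureIrreducible`» and every registered stub are untouched).  THEOREMS ONLY — no definition, no named fact, no `sorry`.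

WHAT.  The `W`-level form of this seat's Literature theorem `IwasawaTheory.classicalMuVanishes_two_of_relationCert_layer_two_of_sub_three_mem`
(`ClassicalMuVanishesLayerTwoRelationCertificateTwoSplit`, the SPLIT sister of att-p4 g43's `…_layer_two`): the coordinate machinery of att-p4 g43's
`…CubicLayerTwoRelationDoor` (there: `Δ_min ≡ 5 (8)`, two dyadic primes) composed with att-p3 g53's split-stratum door `…CubicSplitStratumRelationDoor`
(three dyadic primes; the `Gal`-coinvariants of `Cl(K_m)/2` are read at `K_1 = ℚ(β,√2)`, where they are cyclic as soon as ONE unit of `ℚ(β)` is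
`≡ ±3 (mod 𝔭'³)` at ONE dyadic prime `𝔭'`).  `W` good ordinary at `2`, no rational `2`-torsion abscissa, **`Δ_min ≡ 1 (8)`**, `Δ_W < 0`, `β` a root of the
`2`-division cubic, `K = ℚ(β)` with `h_K` odd, `2 ∤ d_K`; `𝔭'` of norm `2` and a unit **`ε' ≡ ±3 (mod 𝔭'³)`**; `𝔭₁` of norm `2`, a unit `ε ≡ ±1 (mod 𝔭₁³)` with
`±ε` non-squares; RELATION ROW DATA in `𝓞_K` on the basis `1, s₁, s₂, s₁s₂` of `K_2`, verbatim as in `…CubicLayerTwoRelationDoor`: `q₀` with `(q₀)` maximal,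
`q₀ ≡ ±3 (mod 𝔭₁³)`, `t ∈ ℤ`, `ψ : 𝓞_K → ℤ/q` (`q > 1`, `2` invertible) with `ψ(q₀) = 0`, `P₂(t) = (t²−2)²−2 = 0`, Bézout data `α q₀⁸ + β P₂(t) = q₀`,
`α₁ q₀² + 2t·v₁ = 1`, the square witness (`x, e, z`), the comaximality witness (`a, c, d`), ONE element `y` with `y = λq₀² + μ⋆((t²−2−s₁)(σs₂−t)²)` and
`N_{K_2/K}(y) = ε_y q₀⁴`.  THEN for EVERY cyclotomic `ℤ₂`-extension `κ` of `ℚ(β)`: **`rank₂ Cl(K_m) ≤ 2 ∀ m`, `μ₂(κ) = 0`, `λ₂(κ) ≤ 2`.**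
HABITAT: the split-stratum seeds of att-p3 g53's census (`CENSUS-SPLITDOOR-att-p3-g53.md`) with `h(ℚ(β)) = 1` and `r = rank₂ Cl(K_1) = 1`; first customers
the cubic fields `−431` (`17671a1`), `−503` (`9557a1`), `−1607` (`8035a1`) (this gen's rows).

CELL READING: nothing about any curve is asserted HERE; BSD is not proved; nothing is closed.

References: [Washington1997] §13.1, §13.3 Lemmas 13.15, 13.18, Prop. 13.22–13.23; [Lang1990] Ch. 13 §4 Lemma 4.1; [Gras2003] IV.4; [Fukuda1994] Thm. 1;
[NeukirchANT1999] Ch. I §3, §8, Ch. III (1.6)–(1.7); [Omeara1963] §63B (63:10); [Cohen1993] §4.7, §6.5; tree: att-p3 g48/g49 `…CubicRelationDoor`,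
att-p3 g53 `…CubicSplitStratumRelationDoor`, att-p4 g43 `…CubicLayerTwoRelationDoor`, this seat's Literature file
`IwasawaTheory/ClassicalMuVanishesLayerTwoRelationCertificateTwoSplit`, att-p5 g26 `…CubicKilfordPrimes`.
-/

set_option linter.dupNamespace false
set_option autoImplicit false

noncomputable section

open scoped Classical NumberField nonZeroDivisors

namespace Summit.BirchSwinnertonDyer.BirchSwinnertonDyer.Theorems.AlignedTransportAtTwoCubicSplitStratumLayerTwoRelationDoor

open NumberField IsDedekindDomain Polynomial WeierstrassCurve IntermediateField CongruenceSubgroup Finset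
  Literature.NumberTheory.IwasawaTheory Literature.NumberTheory.GaloisRepresentations
  Literature.NumberTheory.GaloisRepresentations.Herbrand Literature.NumberTheory.GaloisRepresentations.MinkowskiUnit
  Literature.NumberTheory.GaloisRepresentations.CyclicNormIndex
  Literature.NumberTheory.EllipticCurves Literature.NumberTheory.EllipticCurves.Greenberg1999
  Literature.NumberTheory.EllipticCurves.ModularForms
  Literature.NumberTheory.EllipticCurves.Rank1Residual
  Literature.NumberTheory.EllipticCurves.Module
  Literature.NumberTheory.NumberFields Literature.NumberTheory.NumberFields.AmbiguousClass
  Summit.BirchSwinnertonDyer.Rank1Residual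
  Summit.BirchSwinnertonDyer.Rank1Residual.X1.MuLambda
  Summit.BirchSwinnertonDyer.Rank1Residual.X5
  Summit.BirchSwinnertonDyer.Rank1Residual.F1Sign2
  Summit.BirchSwinnertonDyer.BirchSwinnertonDyer.Theorems.Rank1ResidualX1Defs
  Summit.BirchSwinnertonDyer.BirchSwinnertonDyer.Theses.AlignedTransportAtTwo
  Summit.BirchSwinnertonDyer.BirchSwinnertonDyer.Theorems.AlignedTransportAtTwoKilfordStratumShared
  Summit.BirchSwinnertonDyer.BirchSwinnertonDyer.Theorems.AlignedTransportAtTwoCubicCarrierRoad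
  Summit.BirchSwinnertonDyer.BirchSwinnertonDyer.Theorems.AlignedTransportAtTwoCubicKilfordPrimes
  Summit.BirchSwinnertonDyer.BirchSwinnertonDyer.Theorems.AlignedTransportAtTwoCubicDepthDoorGenusCert
  Summit.BirchSwinnertonDyer.BirchSwinnertonDyer.Theorems.AlignedTransportAtTwoCubicPrimesOfEmbeddings
  Summit.BirchSwinnertonDyer.BirchSwinnertonDyer.Theorems.AlignedTransportAtTwoCubicLayerOneDoors

variable (W : WeierstrassCurve ℚ) [W.IsElliptic] [W.IsGloballyMinimal]

set_option synthInstance.maxHeartbeats 400000 in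
set_option maxHeartbeats 1600000 in
/-- **THE LAYER-TWO RELATION DOOR IN COORDINATES ON THE SPLIT STRATUM** for the cubic `2`-torsion field `K = ℚ(β)` (`Δ_min ≡ 1 (8)`: three dyadic
primes; `Δ_W < 0`, `h_K` odd, `2 ∤ d_K`; ONE unit `ε' ≡ ±3 (mod 𝔭'³)` at a norm-`2` ideal `𝔭'`; a norm-`2` ideal `𝔭₁` with a unit `ε ≡ ±1 (mod 𝔭₁³)`, `±ε`
non-squares): from the displayed relation-row data in `𝓞_K` (see the module docstring) — **`rank₂ Cl(K_m) ≤ 2 ∀ m`, `μ₂(κ) = 0`, `λ₂(κ) ≤ 2` for every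
cyclotomic `ℤ₂`-extension `κ` of `K`.**  Three dyadic primes (`…CubicKilfordPrimes.ncard_eq_three_of_onKilfordStratumAtTwo`), `𝓞_K/𝔭 = 𝔽₂` and «all units
`≡ ±1 (mod 𝔭₁³)`» (unit rank one) as in att-p3's `…CubicSplitStratumRelationDoor`; then this seat's
`IwasawaTheory.classicalMuVanishes_two_of_relationCert_layer_two_of_sub_three_mem`. [cite: Washington1997, §13.3 Lemmas 13.15, 13.18, Prop. 13.22–13.23]
[cite: Lang1990, Ch. 13 §4, Lemma 4.1 (PDF pp. 203–204)] [cite: NeukirchANT1999, Ch. III (1.6)–(1.7)] [cite: Omeara1963, §63B (63:10)] [cite: Cohen1993, §4.7, §6.5] -/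
theorem classicalMuVanishes_adjoin_of_relationCert_layer_two_splitStratum (hord : IsOrdinaryAt W 2)
    (ht : ∀ x : ℚ, ¬ HasRationalTwoTorsionX W x) (h81 : minimalDiscriminantInt W % 8 = 1) (hΔ : W.Δ < 0)
    {β : AlgebraicClosure ℚ} (hβ : aeval β W.twoTorsionPolynomial.toPoly = 0)
    (hh : haveI : FiniteDimensional ℚ ↥(IntermediateField.adjoin ℚ ({β} : Set (AlgebraicClosure ℚ))) :=
        IntermediateField.adjoin.finiteDimensional ((AlgebraicClosure.isAlgebraic ℚ).isAlgebraic β).isIntegral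
      haveI : NumberField ↥(IntermediateField.adjoin ℚ ({β} : Set (AlgebraicClosure ℚ))) := NumberField.mk
      ¬ 2 ∣ classNumber ↥(IntermediateField.adjoin ℚ ({β} : Set (AlgebraicClosure ℚ))))
    (hd : haveI : FiniteDimensional ℚ ↥(IntermediateField.adjoin ℚ ({β} : Set (AlgebraicClosure ℚ))) :=
        IntermediateField.adjoin.finiteDimensional ((AlgebraicClosure.isAlgebraic ℚ).isAlgebraic β).isIntegral
      haveI : NumberField ↥(IntermediateField.adjoin ℚ ({β} : Set (AlgebraicClosure ℚ))) := NumberField.mk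
      ¬ (2 : ℤ) ∣ NumberField.discr ↥(IntermediateField.adjoin ℚ ({β} : Set (AlgebraicClosure ℚ))))
    (𝔭' : Ideal (𝓞 ↥(IntermediateField.adjoin ℚ ({β} : Set (AlgebraicClosure ℚ)))))
    (hN' : haveI : FiniteDimensional ℚ ↥(IntermediateField.adjoin ℚ ({β} : Set (AlgebraicClosure ℚ))) :=
        IntermediateField.adjoin.finiteDimensional ((AlgebraicClosure.isAlgebraic ℚ).isAlgebraic β).isIntegral
      haveI : NumberField ↥(IntermediateField.adjoin ℚ ({β} : Set (AlgebraicClosure ℚ))) := NumberField.mk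
      Ideal.absNorm 𝔭' = 2)
    {ε' : (𝓞 ↥(IntermediateField.adjoin ℚ ({β} : Set (AlgebraicClosure ℚ))))ˣ}
    (hε' : (ε' : 𝓞 ↥(IntermediateField.adjoin ℚ ({β} : Set (AlgebraicClosure ℚ)))) - 3 ∈ 𝔭' ^ 3 ∨
      (ε' : 𝓞 ↥(IntermediateField.adjoin ℚ ({β} : Set (AlgebraicClosure ℚ)))) + 3 ∈ 𝔭' ^ 3)
    (𝔭₁ : Ideal (𝓞 ↥(IntermediateField.adjoin ℚ ({β} : Set (AlgebraicClosure ℚ)))))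
    (hN : haveI : FiniteDimensional ℚ ↥(IntermediateField.adjoin ℚ ({β} : Set (AlgebraicClosure ℚ))) :=
        IntermediateField.adjoin.finiteDimensional ((AlgebraicClosure.isAlgebraic ℚ).isAlgebraic β).isIntegral
      haveI : NumberField ↥(IntermediateField.adjoin ℚ ({β} : Set (AlgebraicClosure ℚ))) := NumberField.mk
      Ideal.absNorm 𝔭₁ = 2)
    {ε : (𝓞 ↥(IntermediateField.adjoin ℚ ({β} : Set (AlgebraicClosure ℚ))))ˣ} (hε : (ε : 𝓞 ↥(IntermediateField.adjoin ℚ ({β} : Set (AlgebraicClosure ℚ)))) - 1 ∈ 𝔭₁ ^ 3 ∨ (ε : 𝓞 ↥(IntermediateField.adjoin ℚ ({β} : Set (AlgebraicClosure ℚ)))) + 1 ∈ 𝔭₁ ^ 3) (hnsq : ∀ z : (𝓞 ↥(IntermediateField.adjoin ℚ ({β} : Set (AlgebraicClosure ℚ))))ˣ, ε ≠ z ^ 2 ∧ ε ≠ -z ^ 2)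
    (κP : ZpExtension ↥(IntermediateField.adjoin ℚ ({β} : Set (AlgebraicClosure ℚ))) 2) (hκP : κP.IsCyclotomic)
    (q₀ : 𝓞 ↥(IntermediateField.adjoin ℚ ({β} : Set (AlgebraicClosure ℚ)))) (hq₀ : (Ideal.span {q₀}).IsMaximal) (hπ : q₀ - 3 ∈ 𝔭₁ ^ 3 ∨ q₀ + 3 ∈ 𝔭₁ ^ 3)
    (t : ℤ) {q : ℕ} (hq : 1 < q) (ψ : 𝓞 ↥(IntermediateField.adjoin ℚ ({β} : Set (AlgebraicClosure ℚ))) →+* ZMod q) (hψ : ψ q₀ = 0) {ti : ZMod q} (hti : 2 * ti = 1)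
    (hPt : ((t : ZMod q) ^ 2 - 2) ^ 2 - 2 = 0)
    (α β' : 𝓞 ↥(IntermediateField.adjoin ℚ ({β} : Set (AlgebraicClosure ℚ)))) (hBez : α * q₀ ^ 8 + β' * (((t : 𝓞 ↥(IntermediateField.adjoin ℚ ({β} : Set (AlgebraicClosure ℚ)))) ^ 2 - 2) ^ 2 - 2) = q₀)
    (α₁ v₁ : 𝓞 ↥(IntermediateField.adjoin ℚ ({β} : Set (AlgebraicClosure ℚ)))) (hC1 : α₁ * q₀ ^ 2 + v₁ * (2 * (t : 𝓞 ↥(IntermediateField.adjoin ℚ ({β} : Set (AlgebraicClosure ℚ))))) = 1)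
    (x₀ x₁ x₂ x₃ e₀ e₁ e₂ e₃ z₀ z₁ z₂ z₃ : 𝓞 ↥(IntermediateField.adjoin ℚ ({β} : Set (AlgebraicClosure ℚ))))
    (hsq₀ : x₀ * q₀ ^ 4 + q₀ ^ 2 * (2 * e₃ - (t : 𝓞 ↥(IntermediateField.adjoin ℚ ({β} : Set (AlgebraicClosure ℚ)))) * e₀) + (2 * z₀ - 2 * z₁ - 4 * (t : 𝓞 ↥(IntermediateField.adjoin ℚ ({β} : Set (AlgebraicClosure ℚ)))) * z₃ + (t : 𝓞 ↥(IntermediateField.adjoin ℚ ({β} : Set (AlgebraicClosure ℚ)))) ^ 2 * z₀) = q₀ ^ 2)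
    (hsq₁ : x₁ * q₀ ^ 4 + q₀ ^ 2 * (e₂ - (t : 𝓞 ↥(IntermediateField.adjoin ℚ ({β} : Set (AlgebraicClosure ℚ)))) * e₁) + (-z₀ + 2 * z₁ - 2 * (t : 𝓞 ↥(IntermediateField.adjoin ℚ ({β} : Set (AlgebraicClosure ℚ)))) * z₂ + (t : 𝓞 ↥(IntermediateField.adjoin ℚ ({β} : Set (AlgebraicClosure ℚ)))) ^ 2 * z₁) = 0)
    (hsq₂ : x₂ * q₀ ^ 4 + q₀ ^ 2 * (-e₀ + 2 * e₁ - (t : 𝓞 ↥(IntermediateField.adjoin ℚ ({β} : Set (AlgebraicClosure ℚ)))) * e₂) + (2 * z₂ - 2 * z₃ + 2 * (t : 𝓞 ↥(IntermediateField.adjoin ℚ ({β} : Set (AlgebraicClosure ℚ)))) * z₀ - 4 * (t : 𝓞 ↥(IntermediateField.adjoin ℚ ({β} : Set (AlgebraicClosure ℚ)))) * z₁ + (t : 𝓞 ↥(IntermediateField.adjoin ℚ ({β} : Set (AlgebraicClosure ℚ)))) ^ 2 * z₂) = 0)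
    (hsq₃ : x₃ * q₀ ^ 4 + q₀ ^ 2 * (e₀ - e₁ - (t : 𝓞 ↥(IntermediateField.adjoin ℚ ({β} : Set (AlgebraicClosure ℚ)))) * e₃) + (-z₂ + 2 * z₃ - 2 * (t : 𝓞 ↥(IntermediateField.adjoin ℚ ({β} : Set (AlgebraicClosure ℚ)))) * z₀ + 2 * (t : 𝓞 ↥(IntermediateField.adjoin ℚ ({β} : Set (AlgebraicClosure ℚ)))) * z₁ + (t : 𝓞 ↥(IntermediateField.adjoin ℚ ({β} : Set (AlgebraicClosure ℚ)))) ^ 2 * z₃) = 0)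
    (a₀ a₁ a₂ a₃ c₀ c₁ c₂ c₃ d₀ d₁ d₂ d₃ : 𝓞 ↥(IntermediateField.adjoin ℚ ({β} : Set (AlgebraicClosure ℚ))))
    (hC2₀ : a₀ * q₀ ^ 2 + (-2 * c₀ - 2 * c₁ + (t : 𝓞 ↥(IntermediateField.adjoin ℚ ({β} : Set (AlgebraicClosure ℚ)))) ^ 2 * c₀) + (2 * d₀ - 2 * d₁ - 4 * (t : 𝓞 ↥(IntermediateField.adjoin ℚ ({β} : Set (AlgebraicClosure ℚ)))) * d₃ + (t : 𝓞 ↥(IntermediateField.adjoin ℚ ({β} : Set (AlgebraicClosure ℚ)))) ^ 2 * d₀) = 1)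
    (hC2₁ : a₁ * q₀ ^ 2 + (-c₀ - 2 * c₁ + (t : 𝓞 ↥(IntermediateField.adjoin ℚ ({β} : Set (AlgebraicClosure ℚ)))) ^ 2 * c₁) + (-d₀ + 2 * d₁ - 2 * (t : 𝓞 ↥(IntermediateField.adjoin ℚ ({β} : Set (AlgebraicClosure ℚ)))) * d₂ + (t : 𝓞 ↥(IntermediateField.adjoin ℚ ({β} : Set (AlgebraicClosure ℚ)))) ^ 2 * d₁) = 0)
    (hC2₂ : a₂ * q₀ ^ 2 + (-2 * c₂ - 2 * c₃ + (t : 𝓞 ↥(IntermediateField.adjoin ℚ ({β} : Set (AlgebraicClosure ℚ)))) ^ 2 * c₂) + (2 * d₂ - 2 * d₃ + 2 * (t : 𝓞 ↥(IntermediateField.adjoin ℚ ({β} : Set (AlgebraicClosure ℚ)))) * d₀ - 4 * (t : 𝓞 ↥(IntermediateField.adjoin ℚ ({β} : Set (AlgebraicClosure ℚ)))) * d₁ + (t : 𝓞 ↥(IntermediateField.adjoin ℚ ({β} : Set (AlgebraicClosure ℚ)))) ^ 2 * d₂) = 0)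
    (hC2₃ : a₃ * q₀ ^ 2 + (-c₂ - 2 * c₃ + (t : 𝓞 ↥(IntermediateField.adjoin ℚ ({β} : Set (AlgebraicClosure ℚ)))) ^ 2 * c₃) + (-d₂ + 2 * d₃ - 2 * (t : 𝓞 ↥(IntermediateField.adjoin ℚ ({β} : Set (AlgebraicClosure ℚ)))) * d₀ + 2 * (t : 𝓞 ↥(IntermediateField.adjoin ℚ ({β} : Set (AlgebraicClosure ℚ)))) * d₁ + (t : 𝓞 ↥(IntermediateField.adjoin ℚ ({β} : Set (AlgebraicClosure ℚ)))) ^ 2 * d₃) = 0)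
    (y₀ y₁ y₂ y₃ l₀ l₁ l₂ l₃ m₀ m₁ m₂ m₃ : 𝓞 ↥(IntermediateField.adjoin ℚ ({β} : Set (AlgebraicClosure ℚ))))
    (hy₀ : y₀ = l₀ * q₀ ^ 2 + (-2 * m₀ + 4 * (t : 𝓞 ↥(IntermediateField.adjoin ℚ ({β} : Set (AlgebraicClosure ℚ)))) * m₂ + 8 * (t : 𝓞 ↥(IntermediateField.adjoin ℚ ({β} : Set (AlgebraicClosure ℚ)))) * m₃ - 4 * (t : 𝓞 ↥(IntermediateField.adjoin ℚ ({β} : Set (AlgebraicClosure ℚ)))) ^ 2 * m₁ - 4 * (t : 𝓞 ↥(IntermediateField.adjoin ℚ ({β} : Set (AlgebraicClosure ℚ)))) ^ 3 * m₃ + (t : 𝓞 ↥(IntermediateField.adjoin ℚ ({β} : Set (AlgebraicClosure ℚ)))) ^ 4 * m₀))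
    (hy₁ : y₁ = l₁ * q₀ ^ 2 + (-2 * m₁ + 4 * (t : 𝓞 ↥(IntermediateField.adjoin ℚ ({β} : Set (AlgebraicClosure ℚ)))) * m₂ + 4 * (t : 𝓞 ↥(IntermediateField.adjoin ℚ ({β} : Set (AlgebraicClosure ℚ)))) * m₃ - 2 * (t : 𝓞 ↥(IntermediateField.adjoin ℚ ({β} : Set (AlgebraicClosure ℚ)))) ^ 2 * m₀ - 2 * (t : 𝓞 ↥(IntermediateField.adjoin ℚ ({β} : Set (AlgebraicClosure ℚ)))) ^ 3 * m₂ + (t : 𝓞 ↥(IntermediateField.adjoin ℚ ({β} : Set (AlgebraicClosure ℚ)))) ^ 4 * m₁))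
    (hy₂ : y₂ = l₂ * q₀ ^ 2 + (-2 * m₂ + 4 * (t : 𝓞 ↥(IntermediateField.adjoin ℚ ({β} : Set (AlgebraicClosure ℚ)))) * m₁ - 4 * (t : 𝓞 ↥(IntermediateField.adjoin ℚ ({β} : Set (AlgebraicClosure ℚ)))) ^ 2 * m₃ + 2 * (t : 𝓞 ↥(IntermediateField.adjoin ℚ ({β} : Set (AlgebraicClosure ℚ)))) ^ 3 * m₀ - 4 * (t : 𝓞 ↥(IntermediateField.adjoin ℚ ({β} : Set (AlgebraicClosure ℚ)))) ^ 3 * m₁ + (t : 𝓞 ↥(IntermediateField.adjoin ℚ ({β} : Set (AlgebraicClosure ℚ)))) ^ 4 * m₂))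
    (hy₃ : y₃ = l₃ * q₀ ^ 2 + (-2 * m₃ + 2 * (t : 𝓞 ↥(IntermediateField.adjoin ℚ ({β} : Set (AlgebraicClosure ℚ)))) * m₀ - 2 * (t : 𝓞 ↥(IntermediateField.adjoin ℚ ({β} : Set (AlgebraicClosure ℚ)))) ^ 2 * m₂ - 2 * (t : 𝓞 ↥(IntermediateField.adjoin ℚ ({β} : Set (AlgebraicClosure ℚ)))) ^ 3 * m₀ + 2 * (t : 𝓞 ↥(IntermediateField.adjoin ℚ ({β} : Set (AlgebraicClosure ℚ)))) ^ 3 * m₁ + (t : 𝓞 ↥(IntermediateField.adjoin ℚ ({β} : Set (AlgebraicClosure ℚ)))) ^ 4 * m₃))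
    (εy : (𝓞 ↥(IntermediateField.adjoin ℚ ({β} : Set (AlgebraicClosure ℚ))))ˣ) (hNy : (y₀ ^ 2 + 2 * y₁ ^ 2 - 2 * y₂ ^ 2 - 4 * y₃ ^ 2 - 4 * y₂ * y₃) ^ 2 - 2 * (2 * y₀ * y₁ - y₂ ^ 2 - 2 * y₃ ^ 2 - 4 * y₂ * y₃) ^ 2 = εy * q₀ ^ 4) :
    (∀ m, classGroupPRank κP m ≤ 2) ∧ ClassicalMuVanishes κP ∧ classicalLambda κP ≤ 2 := by
  have hirr := AlignedTransportAtTwoSeed.irr_two_of_forall_not_hasRationalTwoTorsionX W ht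
  have hβint : IsIntegral ℚ β := ((AlgebraicClosure.isAlgebraic ℚ).isAlgebraic β).isIntegral
  haveI : FiniteDimensional ℚ ↥(IntermediateField.adjoin ℚ ({β} : Set (AlgebraicClosure ℚ))) := IntermediateField.adjoin.finiteDimensional hβint
  haveI : NumberField ↥(IntermediateField.adjoin ℚ ({β} : Set (AlgebraicClosure ℚ))) := NumberField.mk
  haveI : Fact (Nat.Prime 2) := ⟨Nat.prime_two⟩
  have h3 : Module.finrank ℚ ↥(IntermediateField.adjoin ℚ ({β} : Set (AlgebraicClosure ℚ))) = 3 :=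
    AddKatoTwo.finrank_adjoin_root_twoTorsionPolynomial_eq_three W hirr hβ
  have hodd3 : ¬ 2 ∣ Module.finrank ℚ ↥(IntermediateField.adjoin ℚ ({β} : Set (AlgebraicClosure ℚ))) := by rw [h3]; decide
  have hoddK : Odd (Module.finrank ℚ ↥(IntermediateField.adjoin ℚ ({β} : Set (AlgebraicClosure ℚ)))) :=
    Nat.odd_iff.mpr (Nat.two_dvd_ne_zero.mp hodd3)
  have hrank : Units.rank ↥(IntermediateField.adjoin ℚ ({β} : Set (AlgebraicClosure ℚ))) = 1 :=
    units_rank_eq_one_of_nrRealPlaces_eq_one _ h3 (nrRealPlaces_adjoin_root_twoTorsionPolynomial_eq_one W hΔ hirr hβ)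
  -- exactly three primes above `2` (`Δ_min ≡ 1 (mod 8)`: ON the Kilford stratum)
  have hs := (onKilfordStratumAtTwo_iff_minimalDiscriminantInt_emod_eight W hord).mpr h81
  have h3card := AlignedTransportAtTwoCubicKilfordPrimes.ncard_eq_three_of_onKilfordStratumAtTwo W hord ht hs h3
    (AlignedTransportAtTwoCubicKilfordPrimes.aeval_four_mul_gen_twoDivisionUCubic W hβ)
  -- the dyadic prime `𝔭₁` of degree one; all units `≡ ±1 (mod 𝔭₁³)`
  obtain ⟨h𝔭₁, hP0, h2P, hcard⟩ := isPrime_and_mem_of_absNorm_eq_two 𝔭₁ hN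
  haveI := h𝔭₁
  haveI : 𝔭₁.IsMaximal := h𝔭₁.isMaximal hP0
  have hres := forall_mem_or_sub_one_mem_of_card_quotient_eq_two 𝔭₁ hcard
  have h2P' : (2 : 𝓞 ↥(IntermediateField.adjoin ℚ ({β} : Set (AlgebraicClosure ℚ)))) ∉ 𝔭₁ ^ 2 := two_not_mem_sq_of_not_dvd_discr hd 𝔭₁ h2P
  have hunits := forall_units_sub_one_mem_or_add_one_mem_of_rank_eq_one hoddK hrank 𝔭₁ hP0 hres h2P h2P' hε hnsq
  -- the dyadic prime `𝔭'` of degree one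
  obtain ⟨h𝔭', hP0', h2P'', hcard'⟩ := isPrime_and_mem_of_absNorm_eq_two 𝔭' hN'
  haveI := h𝔭'
  haveI : 𝔭'.IsMaximal := h𝔭'.isMaximal hP0'
  have hres' := forall_mem_or_sub_one_mem_of_card_quotient_eq_two 𝔭' hcard'
  exact classicalMuVanishes_two_of_relationCert_layer_two_of_sub_three_mem hodd3 hd κP hκP h3card.le hh 𝔭' hres' h2P'' hε' 𝔭₁ hres h2P hunits
    q₀ hq₀ hπ t hq ψ hψ hti hPt α β' hBez α₁ v₁ hC1
    x₀ x₁ x₂ x₃ e₀ e₁ e₂ e₃ z₀ z₁ z₂ z₃ hsq₀ hsq₁ hsq₂ hsq₃ a₀ a₁ a₂ a₃ c₀ c₁ c₂ c₃ d₀ d₁ d₂ d₃ hC2₀ hC2₁ hC2₂ hC2₃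
    y₀ y₁ y₂ y₃ l₀ l₁ l₂ l₃ m₀ m₁ m₂ m₃ hy₀ hy₁ hy₂ hy₃ εy hNy

end Summit.BirchSwinnertonDyer.BirchSwinnertonDyer.Theorems.AlignedTransportAtTwoCubicSplitStratumLayerTwoRelationDoor

end
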